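import Summits.BirchSwinnertonDyer.BirchSwinnertonDyer.Theorems.ThetaPartnerAtTwoSignedMainConjectureCMTwoRankZeroKatoDescentDevissage
import Mathlib.RingTheory.Support
import Mathlib.RingTheory.Artinian.Module
import Mathlib.RingTheory.Nakayama
import Mathlib.RingTheory.FiniteLength
import HarnessLib

/-!
# Kato's descent (Astérisque 295, Lemma 14.15 / 15.13) — file 3/3: the two-variable → one-variable
# descent inequality (clause (g) of the LOWER package modulo five printed facts)

Helper file for crux K2R0P♭ `stmt-BirchSwinnertonDyer-26471`
(`Summit.BirchSwinnertonDyer.BirchSwinnertonDyer.Theses.ThetaPartnerAtTwo.SignedMainConjectureCMTwoRankZeroOfPubOfFlat`,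
route `ThetaPartnerAtTwo`, line `rankzero` v16, lead prover bsd-wall-tp2-p2 g9, 2026-08-28). Pure
commutative algebra, no carriers, no named fact, nothing about elliptic curves; BSD is not proved by
any of this. PURPOSE: clause (g) of the LOWER package (`ℓ_𝔭(𝐇¹(T~)/Λ z_A) ≤ ℓ_𝔭(X₀)`, port spec
LOWER-LENGTH-SOCKET-w2g2.md §5) descends from the two-variable equality on the `K(p^∞𝔣)`-tower
(Johnson-Leung–Kings 2011, Thm. 5.7 with §7.2 "Proof for regular prime ideals", unconditional at
every height-one `𝔮 ∌ p`) through Kato's Lemma 15.13 (Astérisque 295, p. 264: `A = O_λ⟦G_{p^∞𝔣}⟧_𝔮`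
is a regular local ring of dimension `2`, the kernel of `A → O_λ⟦G_∞⟧_𝔭` is principal `= (a)`,
(15.13.1) `H²_𝔮/aH²_𝔮 ≅ H²(T~)_𝔭`, (15.13.2) `0 → H¹_𝔮/aH¹_𝔮 → H¹(T~)_𝔭 → H²_𝔮[a] → 0`) and
Kato's Lemma 14.15 (p. 243–244). Kato himself (Prop. 15.17) descends only the Euler-system
inequality; the reverse inequality needed here uses ONE further printed input, Kato Thm. 12.4 (2)
(`𝐇¹(T~)` is torsion free, all `p`; for CM forms by 15.15), in the form "`Ann_A(z~) ⊆ (a)`".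

## Contents of this file (all PROVED; theorem-only)
* `tors_quotient_span_eq_bot` : `(H/Az)[a] = 0` from `H[a] = 0`, `ker ι = aH`, `Ann(ι z) ⊆ (a)`.
* `length_quotient_span_le_length_quotSMulTop` : **the descent inequality** — with `N = H/Az`,
  `ι : H → H~` (`ker ι = aH`, `ℓ_A(H~/ι H) ≤ ℓ_A(M[a])`, `Ann(ι z) ⊆ (a)`) and the two-variable
  comparison `ℓ_𝔮(N) ≤ ℓ_𝔮(M)` at the height-one `𝔮 ∌ a`: `ℓ_A(H~/A·ι z) ≤ ℓ_A(M/aM)`.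
TYPED FACTS A CONSUMER MUST SUPPLY (the port's debt, in this file's currency): Kato 15.13 (1)
(`A` Noetherian local domain, `dim ≤ 2`, `a ∈ 𝔪_A`), (15.13.1) (`M/aM ≅ H²(T~)_𝔭`), (15.13.2)
(`ker ι = aH`, `H~/ι(H) ≅ M[a]`), Kato 12.4 (2) (`Ann_A(ι z) ⊆ (a)`), the supports of `M` and
`N` off the height-one primes `∋ a` (Kato 12.4 (1)–(2) for `f_A` + Nakayama), and JLK §7.2
transported to `A` (`ℓ_𝔮(N) ≤ ℓ_𝔮(M)` at `𝔮 ∌ a`).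

## References
* K. Kato, *p-adic Hodge theory and values of zeta functions of modular forms*, Astérisque 295
  (2004), Lemma 14.15 (p. 243–244), Lemma 15.13, Prop. 15.17 (p. 264–265), Thm. 12.4 (2) (p. 221).
* J. Johnson-Leung, G. Kings, J. reine angew. Math. 653 (2011), Thm. 5.7, §7.2.
-/

set_option autoImplicit false
set_option linter.dupNamespace false

noncomputable section

open scoped Classical Pointwise

universe u v

namespace Summit.BirchSwinnertonDyer.BirchSwinnertonDyer.Theorems.KatoDescent

open Literature.NumberTheory.EllipticCurves Literature.NumberTheory.EllipticCurves.Module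

/-! ## §5 The descent inequality (clause (g) of the LOWER package modulo Kato 15.13 / 12.4 (2) and JLK §7.2) -/

section Descent

variable {A : Type u} [CommRing A]

/-- **`(H/Az)[a] = 0`** from: `a` is `H`-regular, `ker ι = aH`, and `Ann_A(ι z) ⊆ (a)` — the
algebraic content of "Kato Thm. 12.4 (2) (`𝐇¹(T~)` torsion free) kills the defect term of the
descent": if `a·h = b·z` then `b·ι(z) = ι(a·h) = 0`, so `b = c·a`, so `a·(h − c·z) = 0`, so
`h = c·z ∈ Az`. [cite: Kato2004Asterisque, Thm. 12.4 (2) (p. 221) and (15.13.2) (p. 264)] -/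
theorem tors_quotient_span_eq_bot {a : A} {H W : Type*} [AddCommGroup H] [Module A H]
    [AddCommGroup W] [Module A W] (ι : H →ₗ[A] W) (hHa : tors a H = ⊥)
    (hker : LinearMap.ker ι = a • (⊤ : Submodule A H)) (z : H)
    (hz : ∀ b : A, b • ι z = 0 → b ∈ Ideal.span {a}) :
    tors a (H ⧸ Submodule.span A {z}) = ⊥ := by
  rw [eq_bot_iff]
  intro x hx
  induction x using Submodule.Quotient.induction_on with
  | H h =>
    rw [mem_tors_iff, ← Submodule.Quotient.mk_smul, Submodule.Quotient.mk_eq_zero,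
      Submodule.mem_span_singleton] at hx
    obtain ⟨b, hb⟩ := hx
    -- `b • ι z = ι (a • h) = 0`
    have hιah : ι (a • h) = 0 := by
      rw [← LinearMap.mem_ker, hker]
      exact (mem_smul_top_iff (a • h)).mpr ⟨h, rfl⟩
    have hb0 : b • ι z = 0 := by rw [← map_smul, hb, hιah]
    obtain ⟨c, rfl⟩ := Ideal.mem_span_singleton'.mp (hz b hb0)
    -- `a • (h - c • z) = 0`, so `h = c • z`
    have hmem : h - c • z ∈ tors a H := by
      rw [mem_tors_iff, smul_sub, ← hb, smul_smul, mul_comm, sub_self]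
    rw [hHa, Submodule.mem_bot, sub_eq_zero] at hmem
    rw [Submodule.mem_bot, hmem, Submodule.Quotient.mk_smul, ← Submodule.Quotient.mk_smul,
      Submodule.Quotient.mk_eq_zero]
    exact Submodule.smul_mem _ c (Submodule.mem_span_singleton_self z)

variable [IsNoetherianRing A] [IsLocalRing A] [IsDomain A] [Ring.KrullDimLE 2 A]

/-- **The descent inequality (two variables → one).** Let `A` be a Noetherian local domain of
dimension `≤ 2` and `a ∈ 𝔪_A` (Kato 15.13 (1): `A = O_λ⟦G_{p^∞𝔣}⟧_𝔮`, `(a) = ker(A → O_λ⟦G_∞⟧_𝔭)`).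
Let `M` (`= H²_𝔮`) be finitely generated torsion with no support at the height-one primes `∋ a`;
let `H` (`= H¹_𝔮`) be finitely generated with `H[a] = 0`, `z ∈ H` (the elliptic zeta element) with
`N = H/Az` torsion and without support at the height-one primes `∋ a`; let `ι : H → H~`
(`= H¹(T~)_𝔭`, (15.13.2)) be `A`-linear with `ker ι = aH` and `ℓ_A(H~/ι(H)) ≤ ℓ_A(M[a])`
((15.13.2): the cokernel IS `M[a]`), and `Ann_A(ι z) ⊆ (a)` (Kato 12.4 (2): `H~` is torsion free over
the domain `A/aA` and `ι z ≠ 0`). If the TWO-VARIABLE comparison `ℓ_{A_𝔮}(N_𝔮) ≤ ℓ_{A_𝔮}(M_𝔮)` holds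
at every height-one `𝔮 ∌ a` (Johnson-Leung–Kings 2011, Thm. 5.7 / §7.2 at the regular primes), then
**`ℓ_A(H~/A·ι z) ≤ ℓ_A(M/aM)`** (`= ℓ_𝔭(H²(T~))` by (15.13.1)) — i.e. clause (g)
`ℓ_𝔭(𝐇¹(T~)/Λz) ≤ ℓ_𝔭(𝐇²(T~))` of the LOWER package. Proof: `ℓ(H~/ι z) = ℓ(N/aN) + ℓ(H~/ι H)`,
`ℓ(N/aN) = ℓ(N[a]) + Φ_a(N) = Φ_a(N) ≤ Φ_a(M)` (Lemma 14.15 + `tors_quotient_span_eq_bot`),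
`Φ_a(M) + ℓ(M[a]) = ℓ(M/aM)` (Lemma 14.15).
[cite: Kato2004Asterisque, Lemma 14.15 (p. 243–244), Lemma 15.13 and Prop. 15.17 (p. 264–265), Thm. 12.4 (2)]
[cite: JohnsonLeungKings2011, Thm. 5.7 and §7.2] -/
theorem length_quotient_span_le_length_quotSMulTop {a : A} (ha : a ∈ IsLocalRing.maximalIdeal A)
    {M : Type v} [AddCommGroup M] [Module A M] [Module.Finite A M] (hM : Module.IsTorsion A M)
    (hMa : ∀ 𝔮 : PrimeSpectrum A, 𝔮.asIdeal.height = 1 → a ∈ 𝔮.asIdeal → lengthAt A M 𝔮 = 0)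
    {H : Type v} [AddCommGroup H] [Module A H] [Module.Finite A H] (hHa : tors a H = ⊥) (z : H)
    (hN : Module.IsTorsion A (H ⧸ Submodule.span A {z}))
    (hNa : ∀ 𝔮 : PrimeSpectrum A, 𝔮.asIdeal.height = 1 → a ∈ 𝔮.asIdeal →
      lengthAt A (H ⧸ Submodule.span A {z}) 𝔮 = 0)
    (hcmp : ∀ 𝔮 : PrimeSpectrum A, 𝔮.asIdeal.height = 1 → a ∉ 𝔮.asIdeal →
      lengthAt A (H ⧸ Submodule.span A {z}) 𝔮 ≤ lengthAt A M 𝔮)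
    {W : Type*} [AddCommGroup W] [Module A W] (ι : H →ₗ[A] W)
    (hker : LinearMap.ker ι = a • (⊤ : Submodule A H))
    (hcoker : Module.length A (W ⧸ LinearMap.range ι) ≤ Module.length A (tors a M))
    (hz : ∀ b : A, b • ι z = 0 → b ∈ Ideal.span {a}) :
    Module.length A (W ⧸ Submodule.span A {ι z}) ≤ Module.length A (QuotSMulTop a M) := by
  set Z : Submodule A H := Submodule.span A {z} with hZ
  set S : Submodule A W := Submodule.span A {ι z} with hS
  have hSle : S ≤ LinearMap.range ι := by
    rw [hS, Submodule.span_singleton_le_iff_mem]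
    exact ⟨z, rfl⟩
  -- `ℓ(W/S) = ℓ((range ι)/S) + ℓ(W/range ι)`
  have h1 : Module.length A (W ⧸ S) =
      Module.length A ((LinearMap.range ι).map S.mkQ) + Module.length A (W ⧸ LinearMap.range ι) := by
    rw [Module.length_eq_add_of_exact ((LinearMap.range ι).map S.mkQ).subtype
      ((LinearMap.range ι).map S.mkQ).mkQ (Submodule.subtype_injective _)
      (Submodule.mkQ_surjective _) (LinearMap.exact_subtype_mkQ _),
      (Submodule.quotientQuotientEquivQuotient S (LinearMap.range ι) hSle).length_eq]
  -- `(range ι)/S = range (mkQ ∘ ι)` is a quotient of `H/(Z ⊔ aH) ≃ N/aN`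
  set φ : H →ₗ[A] W ⧸ S := S.mkQ ∘ₗ ι with hφ
  have hrange : (LinearMap.range ι).map S.mkQ = LinearMap.range φ := by
    rw [hφ, LinearMap.range_comp]
  have hkerle : Z ⊔ a • (⊤ : Submodule A H) ≤ LinearMap.ker φ := by
    rw [sup_le_iff, hZ, Submodule.span_singleton_le_iff_mem, LinearMap.mem_ker]
    refine ⟨?_, ?_⟩
    · rw [hφ, LinearMap.comp_apply, Submodule.mkQ_apply, Submodule.Quotient.mk_eq_zero, hS]
      exact Submodule.mem_span_singleton_self _
    · rw [← hker]
      intro x hx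
      rw [LinearMap.mem_ker, hφ, LinearMap.comp_apply, LinearMap.mem_ker.mp hx, map_zero]
  have h2 : Module.length A ((LinearMap.range ι).map S.mkQ) ≤
      Module.length A (QuotSMulTop a (H ⧸ Z)) := by
    rw [hrange, ← (LinearMap.quotKerEquivRange φ).length_eq,
      (quotSMulTopQuotientEquivSup a Z).length_eq]
    exact Module.length_le_of_surjective (Submodule.factor hkerle) (Submodule.factor_surjective hkerle)
  -- Lemma 14.15 for `N = H/Z` (with `N[a] = 0`) and for `M`
  obtain ⟨eN, -⟩ := length_quotSMulTop_eq_length_tors_add_Phi' ha (H ⧸ Z) hN hNa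
  rw [tors_quotient_span_eq_bot ι hHa hker z hz, Module.length_bot, zero_add] at eN
  obtain ⟨eM, -⟩ := length_quotSMulTop_eq_length_tors_add_Phi' ha M hM hMa
  -- `Φ_a(N) ≤ Φ_a(M)`
  obtain ⟨s, hsann, hs0⟩ := Submodule.annihilator_top_inter_nonZeroDivisors hM
  have hPhi : Phi a (H ⧸ Z) ≤ Phi a M :=
    Phi_mono (nonZeroDivisors.ne_zero hs0)
      (fun x ↦ Submodule.mem_annihilator.mp hsann x Submodule.mem_top) fun 𝔮 h𝔮 ↦ by
        by_cases ha𝔮 : a ∈ 𝔮.asIdeal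
        · rw [hNa 𝔮 h𝔮 ha𝔮]
          exact bot_le
        · exact hcmp 𝔮 h𝔮 ha𝔮
  calc Module.length A (W ⧸ S)
      = Module.length A ((LinearMap.range ι).map S.mkQ) +
          Module.length A (W ⧸ LinearMap.range ι) := h1
    _ ≤ Module.length A (QuotSMulTop a (H ⧸ Z)) + Module.length A (tors a M) :=
        add_le_add h2 hcoker
    _ = Phi a (H ⧸ Z) + Module.length A (tors a M) := by rw [eN]
    _ ≤ Phi a M + Module.length A (tors a M) := add_le_add hPhi le_rfl
    _ = Module.length A (QuotSMulTop a M) := by rw [eM, add_comm]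

/-! ### Discharging the support hypotheses (Nakayama): consumers hold `ℓ(M/aM) < ∞` -/

omit [IsNoetherianRing A] [IsDomain A] [Ring.KrullDimLE 2 A] in
/-- A finitely generated module of finite length over a local ring is killed by a power of
the maximal ideal (the chain `𝔪ⁿX` stabilises — `X` is Artinian — and Nakayama). [folklore] -/
theorem exists_maximalIdeal_pow_smul_top_eq_bot {X : Type*} [AddCommGroup X] [Module A X]
    [Module.Finite A X] (hX : Module.length A X ≠ ⊤) :
    ∃ n : ℕ, (IsLocalRing.maximalIdeal A) ^ n • (⊤ : Submodule A X) = ⊥ := by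
  have hfl := Module.length_ne_top_iff.mp hX
  rw [isFiniteLength_iff_isNoetherian_isArtinian] at hfl
  obtain ⟨_, _⟩ := hfl
  let f : ℕ →o (Submodule A X)ᵒᵈ :=
    ⟨fun n ↦ OrderDual.toDual ((IsLocalRing.maximalIdeal A) ^ n • (⊤ : Submodule A X)),
      fun m n hmn ↦ OrderDual.toDual_le_toDual.mpr
        (Submodule.smul_mono_left (Ideal.pow_le_pow_right hmn))⟩
  obtain ⟨N, hN⟩ := IsArtinian.monotone_stabilizes f
  refine ⟨N, ?_⟩
  have hNN : (IsLocalRing.maximalIdeal A) ^ N • (⊤ : Submodule A X) =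
      (IsLocalRing.maximalIdeal A) ^ (N + 1) • (⊤ : Submodule A X) :=
    OrderDual.toDual.injective (hN (N + 1) N.le_succ)
  refine Submodule.eq_bot_of_le_smul_of_le_jacobson_bot (IsLocalRing.maximalIdeal A) _
    (IsNoetherian.noetherian _) ?_ (IsLocalRing.maximalIdeal_le_jacobson _)
  conv_lhs => rw [hNN]
  rw [pow_succ', Submodule.mul_smul]

omit [IsNoetherianRing A] [IsDomain A] [Ring.KrullDimLE 2 A] in
/-- **Support off `a` from finite length (Nakayama).** If `M` is finitely generated over the
local ring `A`, `M/aM` has finite length, and `𝔮 ≠ 𝔪_A` is a prime containing `a`, then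
`M_𝔮 = 0`, i.e. `ℓ_𝔮(M) = 0`: `M/aM` is killed by `𝔪ⁿ`, hence by `tⁿ` for some `t ∈ 𝔪 ∖ 𝔮`, so
`(M/aM)_𝔮 = 0`, and `𝔮 ∈ Supp M, a ∈ 𝔮 ⟹ 𝔮 ∈ Supp(M/aM)` (Mathlib's `Module.support_quotSMulTop`).
This discharges the hypotheses `hMa` / `hNa` of `length_quotient_span_le_length_quotSMulTop` for a
consumer holding (15.13.1) `M/aM ≅ H²(T~)_𝔭` (finite length over the DVR `A/aA`: Kato Thm. 12.4 (1))
resp. `N/aN ↪ H¹(T~)_𝔭/z~` (finite length: Thm. 12.4 (2) and `z~ ≠ 0`), when `ht 𝔪_A = 2`.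
[cite: Kato2004Asterisque, Thm. 12.4 (1)–(2) (p. 221), §15.15 (p. 265)] -/
theorem lengthAt_eq_zero_of_length_quotSMulTop_ne_top {a : A} {M : Type*} [AddCommGroup M]
    [Module A M] [Module.Finite A M] (hfin : Module.length A (QuotSMulTop a M) ≠ ⊤)
    {𝔮 : PrimeSpectrum A} (ha𝔮 : a ∈ 𝔮.asIdeal) (hne : 𝔮.asIdeal ≠ IsLocalRing.maximalIdeal A) :
    lengthAt A M 𝔮 = 0 := by
  obtain ⟨n, hn⟩ := exists_maximalIdeal_pow_smul_top_eq_bot hfin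
  have hlt : 𝔮.asIdeal < IsLocalRing.maximalIdeal A :=
    lt_of_le_of_ne (IsLocalRing.le_maximalIdeal 𝔮.isPrime.ne_top) hne
  obtain ⟨t, ht𝔪, ht𝔮⟩ := SetLike.exists_of_lt hlt
  have hkill : Module.IsTorsionBy A (QuotSMulTop a M) (t ^ n) := fun x ↦ by
    have hx : t ^ n • x ∈ (IsLocalRing.maximalIdeal A) ^ n • (⊤ : Submodule A (QuotSMulTop a M)) :=
      Submodule.smul_mem_smul (Ideal.pow_mem_pow ht𝔪 n) Submodule.mem_top
    rwa [hn, Submodule.mem_bot] at hx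
  have h0 : lengthAt A (QuotSMulTop a M) 𝔮 = 0 :=
    lengthAt_eq_zero_of_isTorsionBy hkill 𝔮 fun h ↦ ht𝔮 (𝔮.isPrime.mem_of_pow_mem n h)
  rw [lengthAt_eq_zero_iff, ← Module.notMem_support_iff] at h0 ⊢
  intro hmem
  apply h0
  rw [Module.support_quotSMulTop]
  exact ⟨hmem, by simpa [PrimeSpectrum.mem_zeroLocus] using ha𝔮⟩

/-! ### The EQUALITY version (appended, lead g9): Kato's Conj. 12.10 for the CM form off `(p)`, modulo the same facts -/

/-- `Φ_a` depends only on the local lengths at the height-one primes. [folklore] -/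
theorem Phi_congr {B : Type*} [CommRing B] {a : B} {X X' : Type*} [AddCommGroup X] [Module B X]
    [AddCommGroup X'] [Module B X']
    (h : ∀ 𝔮 : PrimeSpectrum B, 𝔮.asIdeal.height = 1 → lengthAt B X 𝔮 = lengthAt B X' 𝔮) :
    Phi a X = Phi a X' := by
  unfold Phi
  refine finsum_congr fun 𝔮 ↦ ?_
  simp only [phiTerm]
  split_ifs with h1
  · rw [h 𝔮 h1]
  · rfl

/-- **The descent EQUALITY (two variables → one).** Same data as `length_quotient_span_le_length_quotSMulTop`, with
the two-variable comparison an EQUALITY `ℓ_𝔮(N) = ℓ_𝔮(M)` at every height-one `𝔮 ∌ a` (Johnson-Leung–Kings 2011 Thm. 5.7 /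
§7.2) and (15.13.2) read exactly (`ℓ_A(H~/ι H) = ℓ_A(M[a])`): then **`ℓ_A(H~/A·ι z) = ℓ_A(M/aM)`** — i.e., after
(15.13.1)/(15.13.2)/(15.16.1), Kato's Conjecture 12.10 `ℓ_𝔭(𝐇²(T~)) = ℓ_𝔭(𝐇¹(T~)/Z(f,T))` for the CM form `f = f_ψ`
at every height-one `𝔭 ∌ p` (Kato proves `≤` only, Prop. 15.17). Proof: `ker(H → H~/A·ιz) = Az ⊔ aH` exactly, so
`ℓ(H~/A·ιz) = ℓ(N/aN) + ℓ(H~/ιH) = Φ_a(N) + ℓ(M[a])` (Lemma 14.15 with `N[a] = 0`), and `Φ_a(N) = Φ_a(M)`,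
`Φ_a(M) + ℓ(M[a]) = ℓ(M/aM)` (Lemma 14.15).
[cite: Kato2004Asterisque, Conj. 12.10 (p. 224), Lemma 14.15 (pp. 243–244), Lemma 15.13 and Prop. 15.17 (pp. 264–265), Thm. 12.4 (2)]
[cite: JohnsonLeungKings2011, Thm. 5.7 and §7.2] -/
theorem length_quotient_span_eq_length_quotSMulTop {a : A} (ha : a ∈ IsLocalRing.maximalIdeal A)
    {M : Type v} [AddCommGroup M] [Module A M] [Module.Finite A M] (hM : Module.IsTorsion A M)
    (hMa : ∀ 𝔮 : PrimeSpectrum A, 𝔮.asIdeal.height = 1 → a ∈ 𝔮.asIdeal → lengthAt A M 𝔮 = 0)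
    {H : Type v} [AddCommGroup H] [Module A H] [Module.Finite A H] (hHa : tors a H = ⊥) (z : H)
    (hN : Module.IsTorsion A (H ⧸ Submodule.span A {z}))
    (hNa : ∀ 𝔮 : PrimeSpectrum A, 𝔮.asIdeal.height = 1 → a ∈ 𝔮.asIdeal →
      lengthAt A (H ⧸ Submodule.span A {z}) 𝔮 = 0)
    (hcmp : ∀ 𝔮 : PrimeSpectrum A, 𝔮.asIdeal.height = 1 → a ∉ 𝔮.asIdeal →
      lengthAt A (H ⧸ Submodule.span A {z}) 𝔮 = lengthAt A M 𝔮)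
    {W : Type*} [AddCommGroup W] [Module A W] (ι : H →ₗ[A] W)
    (hker : LinearMap.ker ι = a • (⊤ : Submodule A H))
    (hcoker : Module.length A (W ⧸ LinearMap.range ι) = Module.length A (tors a M))
    (hz : ∀ b : A, b • ι z = 0 → b ∈ Ideal.span {a}) :
    Module.length A (W ⧸ Submodule.span A {ι z}) = Module.length A (QuotSMulTop a M) := by
  set Z : Submodule A H := Submodule.span A {z} with hZ
  set S : Submodule A W := Submodule.span A {ι z} with hS
  have hSle : S ≤ LinearMap.range ι := by
    rw [hS, Submodule.span_singleton_le_iff_mem]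
    exact ⟨z, rfl⟩
  have h1 : Module.length A (W ⧸ S) =
      Module.length A ((LinearMap.range ι).map S.mkQ) + Module.length A (W ⧸ LinearMap.range ι) := by
    rw [Module.length_eq_add_of_exact ((LinearMap.range ι).map S.mkQ).subtype
      ((LinearMap.range ι).map S.mkQ).mkQ (Submodule.subtype_injective _)
      (Submodule.mkQ_surjective _) (LinearMap.exact_subtype_mkQ _),
      (Submodule.quotientQuotientEquivQuotient S (LinearMap.range ι) hSle).length_eq]
  set φ : H →ₗ[A] W ⧸ S := S.mkQ ∘ₗ ι with hφ
  have hrange : (LinearMap.range ι).map S.mkQ = LinearMap.range φ := by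
    rw [hφ, LinearMap.range_comp]
  -- this time the kernel is computed EXACTLY
  have hkereq : LinearMap.ker φ = Z ⊔ a • (⊤ : Submodule A H) := by
    apply le_antisymm
    · intro x hx
      rw [LinearMap.mem_ker, hφ, LinearMap.comp_apply, Submodule.mkQ_apply, Submodule.Quotient.mk_eq_zero, hS,
        Submodule.mem_span_singleton] at hx
      obtain ⟨b, hb⟩ := hx
      have hmem : x - b • z ∈ LinearMap.ker ι := by
        rw [LinearMap.mem_ker, map_sub, map_smul, hb, sub_self]
      rw [hker] at hmem
      have : x = b • z + (x - b • z) := by abel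
      rw [this]
      exact Submodule.add_mem_sup (Submodule.smul_mem _ b (Submodule.mem_span_singleton_self z)) hmem
    · rw [sup_le_iff, hZ, Submodule.span_singleton_le_iff_mem, LinearMap.mem_ker]
      refine ⟨?_, ?_⟩
      · rw [hφ, LinearMap.comp_apply, Submodule.mkQ_apply, Submodule.Quotient.mk_eq_zero, hS]
        exact Submodule.mem_span_singleton_self _
      · rw [← hker]
        intro x hx
        rw [LinearMap.mem_ker, hφ, LinearMap.comp_apply, LinearMap.mem_ker.mp hx, map_zero]
  have h2 : Module.length A ((LinearMap.range ι).map S.mkQ) = Module.length A (QuotSMulTop a (H ⧸ Z)) := by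
    rw [hrange, ← (LinearMap.quotKerEquivRange φ).length_eq, (quotSMulTopQuotientEquivSup a Z).length_eq,
      (Submodule.quotEquivOfEq _ _ hkereq).length_eq]
  obtain ⟨eN, -⟩ := length_quotSMulTop_eq_length_tors_add_Phi' ha (H ⧸ Z) hN hNa
  rw [tors_quotient_span_eq_bot ι hHa hker z hz, Module.length_bot, zero_add] at eN
  obtain ⟨eM, -⟩ := length_quotSMulTop_eq_length_tors_add_Phi' ha M hM hMa
  have hPhi : Phi a (H ⧸ Z) = Phi a M := Phi_congr fun 𝔮 h𝔮 ↦ by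
    by_cases ha𝔮 : a ∈ 𝔮.asIdeal
    · rw [hNa 𝔮 h𝔮 ha𝔮, hMa 𝔮 h𝔮 ha𝔮]
    · exact hcmp 𝔮 h𝔮 ha𝔮
  rw [h1, h2, eN, hcoker, hPhi, eM, add_comm]

end Descent

end Summit.BirchSwinnertonDyer.BirchSwinnertonDyer.Theorems.KatoDescent

end
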